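import Summits.CriticalPhenomena.SAWScalingLimit.Theses.SAWSpinMonotone
import HarnessLib.Audit

/-!
# Crux `SpinMonotone` (stmt-CriticalPhenomena-16769) — birth skeleton `Lines/birth.lean`

Route `SAWSpinMonotone` (sub-problem `SAWScalingLimit`).  Crux, BY NAME:
`Summit.CriticalPhenomena.SAWScalingLimit.Theses.SAWSpinMonotone.SpinMonotone` = (FM): for every
simply connected hexagonal domain `Λ`, boundary mid-edge `a`, vertex `v ∈ Λ` with its three neighbours
`w₀ w₁ w₂`, the modulus of the PORT SUM
`s ↦ ‖F_(Λ∖v)(a,{v,w₀}; x_c, s) + F_(Λ∖v)(a,{v,w₁}; x_c, s) + F_(Λ∖v)(a,{v,w₂}; x_c, s)‖`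
(DCS parafermionic observable of the punctured domain `Λ.erase v`, weight `e^{-isW} x_c^ℓ`, summed over
the three mid-edges of `v` = the spin-`s` transform of the FIRST-ARRIVAL winding law at `v`) is antitone
in the spin `s` on `[0, 3/2]`.

## The line (the card's dictionary "positive trigonometric sums ↦ winding laws", typed)

Three stubs, composed below WITHOUT sorry into the crux by name:

* `stub_windingClassExpansion` — STRUCTURE (provable now, size M/L; lattice geometry + parity).  Every
  walk of `Λ.erase v` from the boundary mid-edge `a` to a port `{v,wᵢ}` starts at the unique endpoint of
  `a` inside `Λ` and ends with the half-edge `wᵢ → v`; each turn of the embedded polyline is `±π/3`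
  (regular hexagons, `turning = arg` of consecutive increments), the hexagonal lattice is bipartite and
  the three final directions into `v` differ by `2π/3`, so ALL windings to ALL three ports lie in one
  coset `θ₀ + (2π/3)ℤ`.  Grouping walks by winding class gives a finitely supported NON-NEGATIVE sequence
  `R` (the first-arrival winding law `A_v` of the card, re-indexed from the minimal winding) with
  `PortSum(s) = e^{-isθ₀} · Σ_{d<N} R_d e^{-is·2πd/3}` for every real `s`.  No simple connectivity and
  no distinctness of the `wᵢ` is needed for this identity (kept out of the hypotheses on purpose).
* `stub_sineCriterion` — DICTIONARY LEMMA (provable now, size M; one-variable calculus).  For a finite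
  exponential sum `G(s) = Σ_{d<N} R_d e^{-is·2πd/3}` one has `|G(s)|² = Σ_{d,d'} R_d R_{d'} cos(2πs(d-d')/3)`
  and `d/ds |G|² = -(2π/3)·P(2πs/3)` with the SINE POLYNOMIAL
  `P(θ) = Σ_{d,d'<N} R_d R_{d'} (d-d') sin((d-d')θ) = 2 Σ_{k≥1} k C_k sin(kθ)`, `C_k = Σ_d R_d R_{d+k}` the
  autocorrelation; hence `P ≥ 0` on `[0, π]` ⇒ `s ↦ |G(s)|` antitone on `[0, 3/2]`.  This is the entrance
  for the card's certificate engine (lag-1 dominance `C_1 ≥ Σ_{k≥2} k² C_k` via `|sin kθ| ≤ k sin θ`,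
  Vietoris / Askey–Steinig positive sine sums, Fejér–Riesz).
* `stub_firstArrivalSinePositivity` — THE HEART (open, size XL = the crux in transferred form).  For
  the first-arrival law of a SIMPLY CONNECTED domain (any `θ₀, N, R ≥ 0` representing the port sum as in
  the expansion stub — the representation is unique up to an index shift, and `P` is shift-invariant),
  the sine polynomial `P(θ)` is `≥ 0` on `[0, π]`.  TRANSFER, why easier: it is the derivative form of
  (FM) on which certificates act term by term (near the boundary the law sits on ≤ 2–3 classes and lag-1
  dominance decides the sign; in the bulk the convolution class 𝓓 of the card is closed and Gaussian
  profiles have `P > 0`); it is exactly as safe as the crux (given the two provable stubs it implies (FM);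
  conversely (FM) for the real-analytic `|G|²` forces `P ≥ 0` on `[0,π]`), and it is where the crux's own
  "why it might fail" lives (crossover depth 5–20: a transient flat-topped law `(1,2,2,1)` would make
  `P(θ) < 0` near `θ = π`).  Simple connectivity is load-bearing here and only here (holes ⇒ gap laws ⇒
  `P < 0`, the card's controls).

`SpinMonotone_of (h₁ : Registered.stub_windingClassExpansion) (h₂ : Registered.stub_sineCriterion)
(h₃ : Registered.stub_firstArrivalSinePositivity) : …SAWSpinMonotone.SpinMonotone` is PROVED below (no
sorry): fix the data of the crux, take `θ₀, N, R` from `h₁`, feed the identity to `h₃` to get `P ≥ 0` on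
`[0,π]`, get antitonicity of `‖G‖` on `[0,3/2]` from `h₂`, and transport it along the identity (the
prefactor `e^{-isθ₀}` is unimodular: `‖PortSum s‖ = ‖G s‖`, `AntitoneOn.congr`).  The `Registered.stub_*`
abbrevs are the stub statements keyed by stub name (skeleton-check convention: the hypotheses of
`SpinMonotone_of` are exactly the declared stubs, each BY NAME); the `example` wires the sorried stub
theorems through it as a definitional consistency check.

Sorries: exactly 3 = `stub_windingClassExpansion`, `stub_sineCriterion`,
`stub_firstArrivalSinePositivity`; zero elsewhere.  Disproof used: none (no `Disproof.lean`, no workfiles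
and no crux ideas on stmt-16769 at registration, `ledger crux ls`).  Negatives honoured: no refuted
statement of the summit is used or restated (the route's only contact with the negatives index,
RetrievalStability of SAWPhaseRetrieval and the all-δ tightness stmt-0772, is downstream of this crux).
BC3 probes (planner folder `bc/probe_*.lean`): for each stub, `stub → SpinMonotone` and
`stub → SAWScalingLimit` by `first | exact? | simpa | simpa [T] | (unfold T; simpa) | aesop` FAIL.
Helper lemmas a prover will want (NOT stubs; land them `--supports stmt-CriticalPhenomena-16769`):
`turning = ±π/3` at a hexagonal vertex for genuine lattice steps; bipartite parity of `hexGraph`;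
`HasDerivAt` of `s ↦ Σ R_d e^{-isc d}` and of its squared norm; the lag-1 certificate
`(∀ k ≥ 2) … C_1 ≥ Σ k² C_k → P ≥ 0 on [0,π]`.
Sources: arXiv:1007.0575 (DCS 2012, Def. 1, Lemma 1 grouping); arXiv:1203.2959 §3; Karlin 1968 ch. 8;
Askey–Steinig 1974 (doi:10.1090/S0002-9947-1974-0338483-2); card
`Summits/CriticalPhenomena/SAWScalingLimit/Ideas/_closed/spin-monotone-winding-laws.md` (K1, P1).
-/

noncomputable section

open scoped BigOperators
open Literature.Probability.RandomPlanarGeometry Literature.Probability.RandomPlanarGeometry.SAW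
open Literature.Probability.LatticeModels

namespace Summit.CriticalPhenomena.SAWScalingLimit.Cruxes.SpinMonotone.Birth

/-! ## The registered stubs -/

/-- **stub — WINDING-CLASS EXPANSION of the port sum (structure; provable now).**  For a boundary
mid-edge `a` of `Λ`, a vertex `v ∈ Λ` and neighbours `w₀ w₁ w₂` of `v`, there are a phase `θ₀`, a bound
`N` and a NON-NEGATIVE sequence `R : ℕ → ℝ` (the first-arrival winding law at `v`, indexed by winding
class from the minimal winding: `R d = Σ {x_c^ℓ(γ) : γ ⊂ Λ∖v from a to a port of v, W(γ) = θ₀ + 2πd/3}`)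
such that for EVERY real spin `s` the port sum of DCS observables of `Λ.erase v` equals
`e^{-isθ₀} Σ_{d<N} R_d e^{-is·2πd/3}`.  Content: all windings from `a` to the three ports of `v` lie in
one coset of `(2π/3)ℤ` (turns are `±π/3`; bipartite parity fixes the number of turns mod 2; the three
directions into `v` differ by `2π/3`), and regrouping the finite sum `Σ_γ e^{-isW(γ)} x_c^ℓ(γ)`.
Why it might fail: only through a mismatch with the library encoding (e.g. a walk allowed to end at a
non-edge `s(v,w)` — excluded here by the adjacency hypotheses; the first/last half-segments are parallel
to `a`, `{v,wᵢ}` so no turn is lost).  Size M/L.  Sources: arXiv:1007.0575 §2 (winding, Def. 1);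
`Literature.Probability.RandomPlanarGeometry.SAW.HexMidEdgeSAW.winding/weight`. -/
theorem stub_windingClassExpansion : ∀ (Λ : Finset Literature.Probability.LatticeModels.HexVertex), ∀ a ∈ Literature.Probability.RandomPlanarGeometry.SAW.hexDomainBoundary Λ, ∀ v ∈ Λ, ∀ w₀ w₁ w₂ : Literature.Probability.LatticeModels.HexVertex, Literature.Probability.LatticeModels.hexGraph.Adj v w₀ → Literature.Probability.LatticeModels.hexGraph.Adj v w₁ → Literature.Probability.LatticeModels.hexGraph.Adj v w₂ → ∃ (θ₀ : ℝ) (N : ℕ) (R : ℕ → ℝ), (∀ d, 0 ≤ R d) ∧ ∀ s : ℝ, Literature.Probability.RandomPlanarGeometry.SAW.hexParafermionicObservable (Λ.erase v) a Literature.Probability.RandomPlanarGeometry.SAW.hexCriticalFugacity s s(v, w₀) + Literature.Probability.RandomPlanarGeometry.SAW.hexParafermionicObservable (Λ.erase v) a Literature.Probability.RandomPlanarGeometry.SAW.hexCriticalFugacity s s(v, w₁) + Literature.Probability.RandomPlanarGeometry.SAW.hexParafermionicObservable (Λ.erase v) a Literature.Probability.RandomPlanarGeometry.SAW.hexCriticalFugacity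 s s(v, w₂) = Complex.exp (-Complex.I * s * θ₀) * ∑ d ∈ Finset.range N, (R d : ℂ) * Complex.exp (-Complex.I * s * (2 * Real.pi * d / 3)) := by
  sorry

/-- **stub — SINE CRITERION for spin monotonicity (dictionary lemma; provable now).**  For any `N` and
real coefficients `R`, if the sine polynomial `P(θ) = Σ_{d,d'<N} R_d R_{d'} (d-d') sin((d-d')θ)`
(`= 2 Σ_{k≥1} k C_k sin kθ`, `C` the autocorrelation of `R`) is non-negative on `[0, π]`, then
`s ↦ ‖Σ_{d<N} R_d e^{-is·2πd/3}‖` is antitone on `[0, 3/2]`.  Proof idea: `|G(s)|²` is the real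
trigonometric polynomial `Σ_{d,d'} R_d R_{d'} cos(2πs(d-d')/3)`, its derivative is `-(2π/3) P(2πs/3) ≤ 0`
for `s ∈ [0,3/2]` (i.e. `θ = 2πs/3 ∈ [0,π]`), so `|G|²`, hence `|G|`, is non-increasing there.
Why it might fail: it does not (elementary calculus: `HasDerivAt` of a finite exponential sum,
`antitoneOn_of_deriv_nonpos` on the convex set `Icc 0 (3/2)`, monotonicity of `√`); stated for all real
`R` (non-negativity is not needed for this direction).  Size M.  Sources: Karlin 1968 ch. 8; Askey–Steinig
1974; card spin-monotone-winding-laws P1 ("certificate lemma … from |sin dθ| ≤ d sin θ"). -/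
theorem stub_sineCriterion : ∀ (N : ℕ) (R : ℕ → ℝ), (∀ θ ∈ Set.Icc (0 : ℝ) Real.pi, 0 ≤ ∑ d ∈ Finset.range N, ∑ d' ∈ Finset.range N, R d * R d' * ((d : ℝ) - d') * Real.sin (((d : ℝ) - d') * θ)) → AntitoneOn (fun s : ℝ => ‖∑ d ∈ Finset.range N, (R d : ℂ) * Complex.exp (-Complex.I * s * (2 * Real.pi * d / 3))‖) (Set.Icc (0 : ℝ) (3 / 2)) := by
  sorry

/-- **stub — FIRST-ARRIVAL SINE POSITIVITY (the heart; OPEN — the crux in transferred form).**  For a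
SIMPLY CONNECTED `Λ`, boundary mid-edge `a`, `v ∈ Λ` with pairwise distinct neighbours `w₀ w₁ w₂`, and
ANY winding-class representation `PortSum(s) = e^{-isθ₀} Σ_{d<N} R_d e^{-is·2πd/3}` (all real `s`) with
`R ≥ 0` — necessarily the first-arrival winding law up to an index shift — the autocorrelation sine
polynomial `P(θ) = Σ_{d,d'<N} R_d R_{d'} (d-d') sin((d-d')θ)` is `≥ 0` for `θ ∈ [0, π]`.
Transfer / why easier: this is (FM) differentiated — the form on which the positivity toolkit acts
(lag-1 dominance `C_1 ≥ Σ_{k≥2} k² C_k` near the boundary; convolution-closure of the class 𝓓 and the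
Gaussian winding profile in the bulk; exact certificates on enumerated laws), equivalent to the crux
given the two provable stubs.  Why it might fail: verbatim the crux's — crossover regime (winding spread
≈ one 120° class, depth 5–20, beyond enumeration): neither lag-1 dominance nor Gaussianity fixes the sign
of `Σ_k k C_k sin kθ` near `θ = π`; a transient flat-topped law `(1,2,2,1)` breaks it; thin
non-face-union `Λ` tested only small.  Holes are excluded by `hexDomainSimplyConnected` (gap laws make
`P < 0`: the card's vertex-holed controls).  Size XL.  Sources: arXiv:1007.0575 (Lemma 1, §4 "the curl
vanishes"); arXiv:1203.2959 §3 Thm 3.1; DuplantierSaleur1988; Karlin1968; card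
spin-monotone-winding-laws (K1; 1 045 387 enumerated laws, 0 violations). -/
theorem stub_firstArrivalSinePositivity : ∀ (Λ : Finset Literature.Probability.LatticeModels.HexVertex), Literature.Probability.RandomPlanarGeometry.SAW.hexDomainSimplyConnected Λ → ∀ a ∈ Literature.Probability.RandomPlanarGeometry.SAW.hexDomainBoundary Λ, ∀ v ∈ Λ, ∀ w₀ w₁ w₂ : Literature.Probability.LatticeModels.HexVertex, Literature.Probability.LatticeModels.hexGraph.Adj v w₀ → Literature.Probability.LatticeModels.hexGraph.Adj v w₁ → Literature.Probability.LatticeModels.hexGraph.Adj v w₂ → w₀ ≠ w₁ → w₁ ≠ w₂ → w₀ ≠ w₂ → ∀ (θ₀ : ℝ) (N : ℕ) (R : ℕ → ℝ), (∀ d, 0 ≤ R d) → (∀ s : ℝ, Literature.Probability.RandomPlanarGeometry.SAW.hexParafermionicObservable (Λ.erase v) a Literature.Probability.RandomPlanarGeometry.SAW.hexCriticalFugacity s s(v, w₀) + Literature.Probability.RandomPlanarGeometry.SAW.hexParafermionicObservable (Λ.erase v) a Literature.Probability.RandomPlanarGeometry.SAW.hexCriticalFugacity s s(v, w₁) + Literature.Probability.RandomPlanarGeometry.SAW.hexParafermionicObservable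 (Λ.erase v) a Literature.Probability.RandomPlanarGeometry.SAW.hexCriticalFugacity s s(v, w₂) = Complex.exp (-Complex.I * s * θ₀) * ∑ d ∈ Finset.range N, (R d : ℂ) * Complex.exp (-Complex.I * s * (2 * Real.pi * d / 3))) → ∀ θ ∈ Set.Icc (0 : ℝ) Real.pi, 0 ≤ ∑ d ∈ Finset.range N, ∑ d' ∈ Finset.range N, R d * R d' * ((d : ℝ) - d') * Real.sin (((d : ℝ) - d') * θ) := by
  sorry

/-! ## Name-keyed aliases of the stub statements (skeleton-check convention: the hypotheses of
`SpinMonotone_of` are exactly the declared stubs, each BY NAME) -/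

namespace Registered

/-- Alias keyed by the stub name: the statement of `stub_windingClassExpansion`. -/
abbrev stub_windingClassExpansion : Prop :=
  ∀ (Λ : Finset Literature.Probability.LatticeModels.HexVertex), ∀ a ∈ Literature.Probability.RandomPlanarGeometry.SAW.hexDomainBoundary Λ, ∀ v ∈ Λ, ∀ w₀ w₁ w₂ : Literature.Probability.LatticeModels.HexVertex, Literature.Probability.LatticeModels.hexGraph.Adj v w₀ → Literature.Probability.LatticeModels.hexGraph.Adj v w₁ → Literature.Probability.LatticeModels.hexGraph.Adj v w₂ → ∃ (θ₀ : ℝ) (N : ℕ) (R : ℕ → ℝ), (∀ d, 0 ≤ R d) ∧ ∀ s : ℝ, Literature.Probability.RandomPlanarGeometry.SAW.hexParafermionicObservable (Λ.erase v) a Literature.Probability.RandomPlanarGeometry.SAW.hexCriticalFugacity s s(v, w₀) + Literature.Probability.RandomPlanarGeometry.SAW.hexParafermionicObservable (Λ.erase v) a Literature.Probability.RandomPlanarGeometry.SAW.hexCriticalFugacity s s(v, w₁) + Literature.Probability.RandomPlanarGeometry.SAW.hexParafermionicObservable (Λ.erase v) a Literature.Probability.RandomPlanarGeometry.SAW.hexCriticalFugacity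 s s(v, w₂) = Complex.exp (-Complex.I * s * θ₀) * ∑ d ∈ Finset.range N, (R d : ℂ) * Complex.exp (-Complex.I * s * (2 * Real.pi * d / 3))

/-- Alias keyed by the stub name: the statement of `stub_sineCriterion`. -/
abbrev stub_sineCriterion : Prop :=
  ∀ (N : ℕ) (R : ℕ → ℝ), (∀ θ ∈ Set.Icc (0 : ℝ) Real.pi, 0 ≤ ∑ d ∈ Finset.range N, ∑ d' ∈ Finset.range N, R d * R d' * ((d : ℝ) - d') * Real.sin (((d : ℝ) - d') * θ)) → AntitoneOn (fun s : ℝ => ‖∑ d ∈ Finset.range N, (R d : ℂ) * Complex.exp (-Complex.I * s * (2 * Real.pi * d / 3))‖) (Set.Icc (0 : ℝ) (3 / 2))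

/-- Alias keyed by the stub name: the statement of `stub_firstArrivalSinePositivity`. -/
abbrev stub_firstArrivalSinePositivity : Prop :=
  ∀ (Λ : Finset Literature.Probability.LatticeModels.HexVertex), Literature.Probability.RandomPlanarGeometry.SAW.hexDomainSimplyConnected Λ → ∀ a ∈ Literature.Probability.RandomPlanarGeometry.SAW.hexDomainBoundary Λ, ∀ v ∈ Λ, ∀ w₀ w₁ w₂ : Literature.Probability.LatticeModels.HexVertex, Literature.Probability.LatticeModels.hexGraph.Adj v w₀ → Literature.Probability.LatticeModels.hexGraph.Adj v w₁ → Literature.Probability.LatticeModels.hexGraph.Adj v w₂ → w₀ ≠ w₁ → w₁ ≠ w₂ → w₀ ≠ w₂ → ∀ (θ₀ : ℝ) (N : ℕ) (R : ℕ → ℝ), (∀ d, 0 ≤ R d) → (∀ s : ℝ, Literature.Probability.RandomPlanarGeometry.SAW.hexParafermionicObservable (Λ.erase v) a Literature.Probability.RandomPlanarGeometry.SAW.hexCriticalFugacity s s(v, w₀) + Literature.Probability.RandomPlanarGeometry.SAW.hexParafermionicObservable (Λ.erase v) a Literature.Probability.RandomPlanarGeometry.SAW.hexCriticalFugacity s s(v,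 w₁) + Literature.Probability.RandomPlanarGeometry.SAW.hexParafermionicObservable (Λ.erase v) a Literature.Probability.RandomPlanarGeometry.SAW.hexCriticalFugacity s s(v, w₂) = Complex.exp (-Complex.I * s * θ₀) * ∑ d ∈ Finset.range N, (R d : ℂ) * Complex.exp (-Complex.I * s * (2 * Real.pi * d / 3))) → ∀ θ ∈ Set.Icc (0 : ℝ) Real.pi, 0 ≤ ∑ d ∈ Finset.range N, ∑ d' ∈ Finset.range N, R d * R d' * ((d : ℝ) - d') * Real.sin (((d : ℝ) - d') * θ)

end Registered

/-! ## The composition: the crux BY NAME from the three stubs -/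

/-- **`SpinMonotone` from the expansion, the criterion and the positivity.**  Fix the data of the crux;
the expansion stub gives `θ₀, N, R ≥ 0` with `PortSum(s) = e^{-isθ₀}·G(s)` for all real `s`; the
positivity stub (which consumes simple connectivity and the distinctness of the ports) gives `P ≥ 0` on
`[0,π]` for this `R`; the criterion turns that into antitonicity of `‖G‖` on `[0,3/2]`; and
`‖PortSum s‖ = ‖G s‖` because `e^{-isθ₀}` is unimodular, so antitonicity transports (`AntitoneOn.congr`).
[cite: DuminilCopinSmirnov2012, Def. 1] -/
theorem SpinMonotone_of (h₁ : Registered.stub_windingClassExpansion)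
    (h₂ : Registered.stub_sineCriterion) (h₃ : Registered.stub_firstArrivalSinePositivity) :
    Summit.CriticalPhenomena.SAWScalingLimit.Theses.SAWSpinMonotone.SpinMonotone := by
  intro Λ hΛ a ha v hv w₀ w₁ w₂ hw₀ hw₁ hw₂ h₀₁ h₁₂ h₀₂
  -- the winding-class expansion of the port sum
  obtain ⟨θ₀, N, R, hR, hid⟩ := h₁ Λ a ha v hv w₀ w₁ w₂ hw₀ hw₁ hw₂
  -- positivity of the autocorrelation sine polynomial of the first-arrival law
  have hP := h₃ Λ hΛ a ha v hv w₀ w₁ w₂ hw₀ hw₁ hw₂ h₀₁ h₁₂ h₀₂ θ₀ N R hR hid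
  -- the phase prefactor is unimodular
  have hunit : ∀ s : ℝ, ‖Complex.exp (-Complex.I * s * θ₀)‖ = 1 := by
    intro s
    rw [Complex.norm_exp]
    simp
  -- the criterion gives antitonicity of the class sum; transport it along the identity
  refine (h₂ N R hP).congr ?_
  intro s _
  simp only [hid s, norm_mul, hunit s, one_mul]

/-- Wiring / consistency check (an `example`, so no named declaration and no extra `sorry` warning): the
sorried stub THEOREMS are exactly the hypotheses of `SpinMonotone_of` (the `Registered.stub_*` abbrevs
unfold to their statements definitionally). -/
example : Summit.CriticalPhenomena.SAWScalingLimit.Theses.SAWSpinMonotone.SpinMonotone :=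
  SpinMonotone_of stub_windingClassExpansion stub_sineCriterion stub_firstArrivalSinePositivity

end Summit.CriticalPhenomena.SAWScalingLimit.Cruxes.SpinMonotone.Birth

end
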